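import Mathlib
import HarnessLib
import HarnessLib.Audit
import Summits.ResolutionOfSingularities.Statement
import Summits.ResolutionOfSingularities.ResolutionOfSingularities.Theorems.WeightedInvariantDescentReducedToIntegral
import HarnessLib.Audit.Status.Attr

/-!
Route: pAlteration

It suffices to show, for every prime p: (PIAlt_p) every integral separated finite-type X over a
field k of char p admits a PURELY INSEPARABLE REGULAR ALTERATION (g : X' -> X proper surjective, X'
integral regular, g finite and universally injective over a dense open of X) [Abramovich-Oort
conjecture = Temkin2013 Conj. 1.3.1], AND (PICover_p) every integral X admitting a finite,
universally injective, surjective morphism onto a REGULAR integral separated finite-type k-scheme Y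
has a resolution.
Lean (elaborates, no `open`):
∀ p : ℕ, p.Prime → (∀ (k : Type) [Field k] [CharP k p] (X : AlgebraicGeometry.Scheme.{0}) (f : X ⟶
AlgebraicGeometry.Spec (.of k)), AlgebraicGeometry.IsSeparated f →
AlgebraicGeometry.LocallyOfFiniteType f → AlgebraicGeometry.QuasiCompact f →
AlgebraicGeometry.IsIntegral X → ∃ (X' : AlgebraicGeometry.Scheme.{0}) (g : X' ⟶ X),
AlgebraicGeometry.IsProper g ∧ AlgebraicGeometry.IsIntegral X' ∧
Literature.AlgebraicGeometry.Resolution.Scheme.IsRegular X' ∧ Function.Surjective g.base ∧ ∃ U :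
X.Opens, Dense (U : Set X) ∧ AlgebraicGeometry.IsFinite (AlgebraicGeometry.morphismRestrict g U) ∧
AlgebraicGeometry.UniversallyInjective (AlgebraicGeometry.morphismRestrict g U)) ∧ (∀ (k : Type)
[Field k] [CharP k p] (Y X : AlgebraicGeometry.Scheme.{0}) (f : Y ⟶ AlgebraicGeometry.Spec (.of k))
(g : X ⟶ Y), AlgebraicGeometry.IsSeparated f → AlgebraicGeometry.LocallyOfFiniteType f →
AlgebraicGeometry.QuasiCompact f → AlgebraicGeometry.IsIntegral Y →
Literature.AlgebraicGeometry.Resolution.Scheme.IsRegular Y → AlgebraicGeometry.IsIntegral X →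
AlgebraicGeometry.IsFinite g → AlgebraicGeometry.UniversallyInjective g → Function.Surjective g.base
→ Literature.AlgebraicGeometry.Resolution.Scheme.HasResolution X)

Rationale: WHY THIS LINE. Alterations are the one tool that works uniformly in char p: DeJong1996 (regular
alteration), DeJong1997 Cor. 5.15
(regular Galois alteration: X resolved "up to quotient singularities and a purely inseparable
extension of R(X)"), Gabber's prime-to-l
refinement (IllusieLaszloOrgogozo2014, Exp. X), and Temkin2017 Thm 1.2.5 (projective
char(X)-alteration with regular source for X of
finite type over any field; separable if k perfect). What separates a p-alteration from a resolution
is exactly a finite purely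
inseparable extension of function fields. The thesis splits this residue in two: PIAlt (make the
alteration purely inseparable —
Temkin2013 Conj. 1.3.1, whose local form along any valuation IS Temkin2013 Thm 1.3.2) and PICover
(resolve finite radicial covers of
regular varieties — the "inseparable case t^p = f", Temkin2013 Rem. 1.3.5(iii), recognised as the
hard core in every approach).
Imported areas: non-archimedean analytic geometry (Temkin's proofs run on Berkovich curves),
ramification/tame distillation (Temkin2017
Thm 3.3.6), Frobenius arithmetic (for X normal over any k of char p, absolute Frobenius factors X''
-> X -> X'' through any finite
radicial X'' -> X, turning "bottom of a radicial cover" into "top of a radicial cover of a Frobenius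
twist").
RANKED CRUXES.
 rank 2  PICover_p (signature A2). Hardest and shared with Valuative (its LU shadow is stmt LUPI) —
a proof in dim 4 already beats the
         literature. Local model filed separately at rank 5.
 rank 3  PIAlt_p (signature A3) — Abramovich-Oort / Temkin2013 Conj 1.3.1; globalising Temkin2013
Thm 1.3.2 is a patching problem for
         inseparable local uniformizations (Temkin2013 Thm 1.3.3 gives a finite Zariski COVER by
such, not one alteration).
 rank 4  PICover_p -> RadicialBottom_p (signature A4): if X'' -> X is finite radicial surjective and
X'' has a resolution then X has one.
         On paper: Stein factorisation + Frobenius twist argument above; informative because it is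
where imperfect k could bite.
 rank 5  Local model (signature A5): Spec of (R[T]/(T^p - a))_red has a resolution for R a regular
finitely generated k-domain, a in R.
 frame   Assembly2 (rank 1, BY NAME, rev 3): PalterationThesis → PicoverToRadicialBottom →
DescentReducedToIntegral → summit —
         normalization + relative normalization of X in K(X') + 'finite p.i. over normal ⇒
universally injective'; true on paper for
         every k because RadicialBottom (rank 4) is an explicit hypothesis; deciding theorem
`closes` := hA2 hT hRB hD (pure logic;
         certified rev 3). The rev-2 inline Assembly (stmt-0553: thesis-body → summit) stays listed
(assembly rows are not droppable)
         and is implied by Assembly2 ∧ rank 4 ∧ reduced→integral; provers should take Assembly2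
(roadmap: evidence on stmt-10476).
KILL CRITERIA. ¬PIAlt_p for some p (a variety with no purely inseparable regular alteration) closes
the route (refuted); ¬PICover is
¬summit. If rank 4 is refuted over imperfect k only, pivot to perfect k + route Descent rank 2.
NOT DECOMPOSED YET. Assembly infrastructure is largely in tree
(Scheme.HasResolution.of_normalization, normalizationIn /
isFinite_normalizationInι, HasResolution.of_isBirational, IsBirational.comp; absoluteFrobenius in
Literature/AlgebraicGeometry/Motives/FrobeniusMorphism.lean serves rank 4) and is NOT itemised
further; embedded/snc versions; the
Galois-alteration variant (DeJong1997 5.15 + resolution of wild quotient singularities Y/G, G a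
p-group) is a sibling thesis to file
only if PIAlt is refuted. Tenure option recorded by refuters g2-3/g2-7/pool-4 (not a route-repair
move): restate PICover with
IsIntegralHom g + X's own finite-type structure, which closes the [k:k^p] = ∞ gap of rank 4. Cone:
no item takes CossartPiltant2019 or
Hironaka1964 as a hypothesis (context only) and
Literature.AlgebraicGeometry.Resolution.ResolutionOfSingularities is the summit itself —
all three live in the module the Statement imports; needs-fact: none.
CHEAPEST FALSIFIER. ¬PIAlt_p on ONE explicit variety: an integral surface over k of char p with two
valuations whose inseparable local
uniformizations (Temkin2013 Thm 1.3.2) cannot be realised by a common purely inseparable regular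
alteration — Temkin2013 §1.3 ('no
global fibration suits all valuations') names exactly this tension; first candidates are the wild
quotient singularities left by
DeJong1997 Cor 5.15. Assembly-side cheap checks are already absorbed by the rev-3 frame: nodal cubic
(normalise first) and
k = F_p(t_1, t_2, …) (Frobenius factor not finite ⇒ RadicialBottom kept as the explicit rank-4
hypothesis).

Novelty: NOVELTY (retriage pass 2026-08-14; search-before-claim: lit search x4 (hybrid fell back to FTS), lit
vsearch x1, lit galaxy search --star pdf x2 (0 hits), lit frontier --since 2020, lit bridges --cross
any; lit read of every hit named below).
NEAREST PRIOR ART.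
(1) AbramovichTemkinWlodarczyk2024 (doi:10.2140/ant.2024.18.1557), p.1563 footnote 1, verbatim: "by
a theorem of de Jong [1997, Corollary 5.15], as stated in [Bergh and Rydh 2019, Theorem 1.4], any
variety X over a field of any characteristic admits a purely inseparable alteration X' -> X with X'
the coarse moduli space of a smooth Deligne-Mumford stack. Thus, if the field is perfect, resolution
of X is reduced to the combination of destackification of a possibly wild Deligne-Mumford stack and
the resolution of a purely inseparable cover of a smooth scheme -- using Frobenius we can realize a
modification of X as a purely inseparable alteration of X'." This IS the route's architecture (p.i.
alteration + resolution of p.i. covers of regular schemes + Frobenius => resolution) in print, over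
PERFECT fields, with a known first step and two open residues (wild destackification; p.i. covers of
smooth schemes = our Picover).
(2) Temkin2013 (arXiv:0804.1554v3) Conj. 1.3.1 p.3 = AbramovichOort2000 Cor. 2.9 / Question 2.13
(arXiv:math/9806100 pp.8-9: "weak resolution up to purely inseparable alterations?"): Pialt
verbatim, "absolutely open"; Rem. 1.3.5(i)-(iii) p.4: the LOCAL form of the whole reduction
(inseparable local uniform  [refs: 10.2140/ant.2024.18.1557, 10.1016/j.jalgebra.2008.03.032, 0804.1554, math/9806100, 1905.00872, 1508.06255, 1710.01805, 2102.03162, doi:10.2140/ant.2024.18.1557, doi:10.1016/j.jalgebra.2008.03.032, AbramovichTemkinWlodarczyk2024, Temkin2013, AbramovichOort2000, CossartPiltant2008, DeJong1996, DeJong1997, Temkin2017, Kollar1997]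

Barriers (technique_class: purely-inseparable-alteration radicial-cover frobenius): BARRIERS (catalogue lean/Literature/Barriers/ResolutionOfSingularities/*.lean; refs are the
catalogue handles Literature.Barriers.ResolutionOfSingularities.<name> as indexed by the gate).
- Literature.Barriers.ResolutionOfSingularities.DimensionFourFrontier : APPLIES to Picover
(stmt-0554) and PicoverLocalModel (stmt-0557), open exactly from dimension 4 (dim <= 3 in tree via
Literature.AlgebraicGeometry.Resolution.hasResolution_of_dim_le_three from the named fact
CossartPiltant2019). The Pialt half uses the catalogued evasion (i) "allow a finite, resp. finite
purely inseparable, extension of the function field" (DeJong1996; Temkin2013 Thm 1.3.2). For Picover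
the route does NOT evade the frontier; the bet is that finite radicial covers of REGULAR varieties
(generically towers of alpha_p-torsors t^p = a, multiplicity <= p^e, transversal over a regular base
in the sense of arXiv:1710.01805) are a structured enough subclass for a dimension-free argument.
- Literature.Barriers.ResolutionOfSingularities.InseparableBaseChange : APPLIES to the assembly step
PicoverToRadicialBottom (stmt-0556) / Assembly: regularity is not stable under inseparable
ground-field extension. Evasion used: HasResolution asks for REGULAR (not smooth) X~ and is absolute
(catalogued evasion (i)), so for F-finite, in particular perfect, k the absolute-Frobenius
factorisation X'' -> X -> X'' (Kollar1997 Prop 6.6, Stacks 0CNF, Temkin2013 Rem 1.3.5(i): h finite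
iff [k:k^p] < oo) goes through on paper. For [k:k^p]

Novelty grade: variant — variant (refuter rreview1-pAlt-0, route-review 2026-08-15). NEAREST PRIOR ART (verified against the items' page-level reground evidence): (1) ATW2024 p.1563 fn 1 prints the architecture over PERFECT fields: 'any variety admits a purely inseparable alteration X' -> X with X' the coarse space of a smo (refuter refuter-rreview1-ResolutionOfSingularities-pAlt-07727138-0, 2026-08-15T18:29:51Z; prior: doi:10.2140/ant.2024.18.1557 (AbramovichTemkinWlodarczyk2024, p.1563 fn 1), arXiv:0804.1554 (Temkin2013, Conj 1.3.1, Thm 1.3.2, Rem 1.3.5(i)-(iii)), arXiv:math/9806100 (AbramovichOort2000, 2.9 / Q 2.13), DeJong1997 Cor 5.15, arXiv:1905.00872 (Bergh-Rydh Thm 1.4), arXiv:1508.06255 (Temkin2017 Thm 1.2.5), arXiv:alg-geom/9503007 (Kollar1997 Prop 6.6), arXiv:1412.0868 (CossartPiltant2019 Thm 1.1), doi)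

History (route lifecycle, newest last):
- 2026-08-16T04:16:17Z · AUTO-CRUX (backfill): PalterationThesis — hypotheses of the deciding theorem that nothing in the route derives are cruxes (operator:999:1085951)
- 2026-08-16T14:43:06Z · LINT AUTOFIX route.multi-assembly: kept Assembly2, dropped Assembly (gate:hygiene)
- 2026-08-23T12:44:25Z · DORMANT — reconciler: no traction for 6.1 d (last activity item-evidence-added at 2026-08-17T10:17:42Z); parked, not closed — `ledger route dormant route-ResolutionOfSing (operator:999:3805556)
- 2026-08-27T16:50:45Z · REACTIVATED — reconciler: reactivated — activity item-evidence-added at 2026-08-27T14:56:31Z after parking at 2026-08-23T12:44:25Z (operator:999:4029366)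

sub-problem: ResolutionOfSingularities · status: open · opened planner-ResolutionOfSingularities-Survey-0 2026-08-13T13:06:08Z · rev 5 · ledger route-ResolutionOfSingularities-pAlteration
GENERATED by the gate from the ledger (D-0016/17). Provers cite these decls: `theorem foo : Summit.ResolutionOfSingularities.ResolutionOfSingularities.Theses.PAlteration.<Decl> := …` in Summits/ResolutionOfSingularities/ResolutionOfSingularities/Theorems/<Name>.lean.
-/

namespace Summit.ResolutionOfSingularities.ResolutionOfSingularities.Theses.PAlteration

open scoped BigOperators Topology Manifold Classical MeasureTheory ProbabilityTheory Matrix InnerProductSpace ComplexConjugate ContinuousMap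
open Filter Set Function TopologicalSpace MeasureTheory

attribute [summit_statement] _root_.ResolutionOfSingularities

/-! Retired items kept as plain definitions (history; not obligations of this route): landed proofs / closed glue still name them. -/

/-- retired stmt-ResolutionOfSingularities-0553 (dropped, gen None) — proved by Summit.ResolutionOfSingularities.ResolutionOfSingularities.Theorems.assembly_proof. -/
def Assembly : Prop :=
  (∀ p : ℕ, p.Prime → (∀ (k : Type) [Field k] [CharP k p] (X : AlgebraicGeometry.Scheme.{0}) (f : X ⟶ AlgebraicGeometry.Spec (.of k)), AlgebraicGeometry.IsSeparated f → AlgebraicGeometry.LocallyOfFiniteType f → AlgebraicGeometry.QuasiCompact f → AlgebraicGeometry.IsIntegral X → ∃ (X' : AlgebraicGeometry.Scheme.{0}) (g : X' ⟶ X), AlgebraicGeometry.IsProper g ∧ AlgebraicGeometry.IsIntegral X' ∧ Literature.AlgebraicGeometry.Resolution.Scheme.IsRegular X' ∧ Function.Surjective g.base ∧ ∃ U : X.Opens, Dense (U : Set X) ∧ AlgebraicGeometry.IsFinite (AlgebraicGeometry.morphismRestrict g U) ∧ AlgebraicGeometry.UniversallyInjective (AlgebraicGeometry.morphismRestrict g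 U)) ∧ (∀ (k : Type) [Field k] [CharP k p] (Y X : AlgebraicGeometry.Scheme.{0}) (f : Y ⟶ AlgebraicGeometry.Spec (.of k)) (g : X ⟶ Y), AlgebraicGeometry.IsSeparated f → AlgebraicGeometry.LocallyOfFiniteType f → AlgebraicGeometry.QuasiCompact f → AlgebraicGeometry.IsIntegral Y → Literature.AlgebraicGeometry.Resolution.Scheme.IsRegular Y → AlgebraicGeometry.IsIntegral X → AlgebraicGeometry.IsFinite g → AlgebraicGeometry.UniversallyInjective g → Function.Surjective g.base → Literature.AlgebraicGeometry.Resolution.Scheme.HasResolution X)) → _root_.ResolutionOfSingularities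

/-- item stmt-ResolutionOfSingularities-0552 · crux (kind.auto-crux: conjecture-grade) · rank 0 · open · by planner
why it might fail: X = PIAlt AND PICover: PIAlt is the widely open Abramovich-Oort conjecture (Temkin2013 Conj 1.3.1), PICover is summit-hard from dim 4 ('inseparable case', Rem 1.3.5(iii)); X -> summit (Assembly) is on paper only for F-finite k: for [k:k^p]=oo it inherits the RadicialBottom gap of stmt-0556.
sources: Temkin2013, AbramovichOort2000, AbramovichTemkinWlodarczyk2024 (fn 1: same architecture over perfect fields), HauserPerlega2019, Literature.AlgebraicGeometry.Resolution.AbramovichOortConjecture, Literature.Barriers.ResolutionOfSingularities.InseparableBaseChange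
For every prime p: (PIAlt_p) every integral separated finite-type X/k, char k = p, has a proper
surjective g : X' -> X with X' integral regular and g finite + universally injective over a dense
open of X (purely inseparable regular alteration; Abramovich-Oort, Temkin2013 Conj 1.3.1); and
(PICover_p) every integral X finite, universally injective and surjective over a regular integral
separated finite-type Y/k has a resolution. -/
@[route_item "route-ResolutionOfSingularities-pAlteration", crux]
def PalterationThesis : Prop :=
  ∀ p : ℕ, p.Prime → (∀ (k : Type) [Field k] [CharP k p] (X : AlgebraicGeometry.Scheme.{0}) (f : X ⟶ AlgebraicGeometry.Spec (.of k)), AlgebraicGeometry.IsSeparated f → AlgebraicGeometry.LocallyOfFiniteType f → AlgebraicGeometry.QuasiCompact f → AlgebraicGeometry.IsIntegral X → ∃ (X' : AlgebraicGeometry.Scheme.{0}) (g : X' ⟶ X), AlgebraicGeometry.IsProper g ∧ AlgebraicGeometry.IsIntegral X' ∧ Literature.AlgebraicGeometry.Resolution.Scheme.IsRegular X' ∧ Function.Surjective g.base ∧ ∃ U : X.Opens, Dense (U : Set X) ∧ AlgebraicGeometry.IsFinite (AlgebraicGeometry.morphismRestrict g U) ∧ AlgebraicGeometry.UniversallyInjective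 (AlgebraicGeometry.morphismRestrict g U)) ∧ (∀ (k : Type) [Field k] [CharP k p] (Y X : AlgebraicGeometry.Scheme.{0}) (f : Y ⟶ AlgebraicGeometry.Spec (.of k)) (g : X ⟶ Y), AlgebraicGeometry.IsSeparated f → AlgebraicGeometry.LocallyOfFiniteType f → AlgebraicGeometry.QuasiCompact f → AlgebraicGeometry.IsIntegral Y → Literature.AlgebraicGeometry.Resolution.Scheme.IsRegular Y → AlgebraicGeometry.IsIntegral X → AlgebraicGeometry.IsFinite g → AlgebraicGeometry.UniversallyInjective g → Function.Surjective g.base → Literature.AlgebraicGeometry.Resolution.Scheme.HasResolution X)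

/-- item stmt-ResolutionOfSingularities-0554 · crux · rank 2 · open · by planner
why it might fail: Open from dim 4, all p: a finite radicial cover of regular Y is generically a tower t_i^p=f_i, Temkin's 'inseparable case, where all bad things can happen' (Rem 1.3.5(iii)); kangaroo points and Hauser-Perlega unbounded residual order (z^{p^3}+F on A^4) live in this class; not-Picover => not-summit.
sources: Temkin2013 (arXiv:0804.1554v3 p.4 Rem 1.3.5(iii)), HauserPerlega2019, CossartPiltant2019 (arXiv:1412.0868 Thm 1.1: dim<=3 only), Literature.AlgebraicGeometry.Resolution.hasResolution_of_dim_le_three, Literature.Barriers.ResolutionOfSingularities.DimensionFourFrontier, Literature.Barriers.ResolutionOfSingularities.hauserPerlega_mohProofBoundFails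
PICover_p: over any field k of char p, if Y is a regular integral separated finite-type k-scheme and
g : X -> Y is finite, universally injective (radicial) and surjective with X integral, then X has a
resolution. The 'inseparable case' (Temkin2013 Rem 1.3.4(iii)); open in dim >= 4. -/
@[route_item "route-ResolutionOfSingularities-pAlteration", crux]
def Picover : Prop :=
  ∀ p : ℕ, p.Prime → ∀ (k : Type) [Field k] [CharP k p] (Y X : AlgebraicGeometry.Scheme.{0}) (f : Y ⟶ AlgebraicGeometry.Spec (.of k)) (g : X ⟶ Y), AlgebraicGeometry.IsSeparated f → AlgebraicGeometry.LocallyOfFiniteType f → AlgebraicGeometry.QuasiCompact f → AlgebraicGeometry.IsIntegral Y → Literature.AlgebraicGeometry.Resolution.Scheme.IsRegular Y → AlgebraicGeometry.IsIntegral X → AlgebraicGeometry.IsFinite g → AlgebraicGeometry.UniversallyInjective g → Function.Surjective g.base → Literature.AlgebraicGeometry.Resolution.Scheme.HasResolution X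

/-- item stmt-ResolutionOfSingularities-0555 · crux · rank 3 · open · by planner
why it might fail: AO2000 2.9/Q.2.13 = Temkin2013 Conj 1.3.1, 'widely open': known per valuation only (Thm 1.3.2; 'no global fibration suits all valuations') or in p-power, not p.i., degree (Temkin2017 1.2.5; dJ97 keeps a Galois part). A variety whose regular alterations all need an Artin-Schreier factor kills it.
sources: Temkin2013 (arXiv:0804.1554v3 p.3 Conj 1.3.1, Thm 1.3.2, Cor 1.3.3), AbramovichOort2000 (arXiv:math/9806100 pp.8-9, 2.9/2.13), Temkin2017 (arXiv:1508.06255 Thm 1.2.5), Literature.AlgebraicGeometry.Resolution.AbramovichOortConjecture (named conjecture, a Prop, not a fact), Literature.AlgebraicGeometry.Resolution.Temkin2013 (per-valuation form, named fact), Literature.Barriers.ResolutionOfSingularities.Cutkosky2014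
PIAlt_p: every integral separated finite-type scheme over a field of char p admits a purely
inseparable regular alteration (Temkin2013 Conjecture 1.3.1 = Abramovich-Oort 2.9). Known locally
along every valuation: Temkin2013 Thm 1.3.2; known with p-power (not purely inseparable) degree:
Temkin2017 Thm 1.2.5. -/
@[route_item "route-ResolutionOfSingularities-pAlteration", crux]
def Pialt : Prop :=
  ∀ p : ℕ, p.Prime → ∀ (k : Type) [Field k] [CharP k p] (X : AlgebraicGeometry.Scheme.{0}) (f : X ⟶ AlgebraicGeometry.Spec (.of k)), AlgebraicGeometry.IsSeparated f → AlgebraicGeometry.LocallyOfFiniteType f → AlgebraicGeometry.QuasiCompact f → AlgebraicGeometry.IsIntegral X → ∃ (X' : AlgebraicGeometry.Scheme.{0}) (g : X' ⟶ X), AlgebraicGeometry.IsProper g ∧ AlgebraicGeometry.IsIntegral X' ∧ Literature.AlgebraicGeometry.Resolution.Scheme.IsRegular X' ∧ Function.Surjective g.base ∧ ∃ U : X.Opens, Dense (U : Set X) ∧ AlgebraicGeometry.IsFinite (AlgebraicGeometry.morphismRestrict g U) ∧ AlgebraicGeometry.UniversallyInjective (AlgebraicGeometry.morphismRestrict g 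U)

/-- item stmt-ResolutionOfSingularities-0556 · crux · rank 4 · closed · proved by Summit.ResolutionOfSingularities.ResolutionOfSingularities.Theorems.picoverToRadicialBottom_proof @ 3180486c3e53 (prover) · by planner
why it might fail: Only printed argument = Frobenius domination (Temkin2013 Rem 1.3.5(i), Kollar1997 6.6, Stacks 0CNF): h:X->X'' FINITE iff [k:k^p]<oo, so for k=F_p(t_1,t_2,..) Picover's IsFinite g is unmet; Frobenius twist / descent to F-finite k_0 lose regularity (y^2=x^p-a); k_0 with k/k_0 separable need not exist.
sources: Temkin2013 (arXiv:0804.1554v3 p.4 Rem 1.3.5(i): 'if [k:k^p]<oo then h is finite'), Kollar1997 (arXiv:alg-geom/9503007 Prop 6.6, Ex 6.5.1), StacksProject (Tags 0CNF, 04DF, 0CC6), Liu2002 (Ex 7.3.15, Rem 4.3.34), Literature.Barriers.ResolutionOfSingularities.InseparableBaseChange, Matsumura1987 (Thm 26.6 separable iff derivations extend; Thm 23.7 regularity descends along faithfully flat maps) - used in the planner's no-F-finite-subfield-with-separable-cofield example, NOTES.md of planner-retriage-ResolutionOfSingularities-pAlteration-g2-0 and route BARRIERS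
PICover_p implies RadicialBottom_p: if g : X'' -> X is finite, universally injective, surjective
between integral separated finite-type k-schemes (char k = p) and X'' has a resolution, then X has a
resolution. On paper: for X normal, absolute Frobenius^m of X'' factors through g, making X a finite
radicial cover of a scheme isomorphic to X''; pull back the resolution of X'' and apply PICover.
Watch imperfect k and non-normal X. -/
@[route_item "route-ResolutionOfSingularities-pAlteration", crux]
def PicoverToRadicialBottom : Prop :=
  ∀ p : ℕ, p.Prime → (∀ (k : Type) [Field k] [CharP k p] (Y X : AlgebraicGeometry.Scheme.{0}) (f : Y ⟶ AlgebraicGeometry.Spec (.of k)) (g : X ⟶ Y), AlgebraicGeometry.IsSeparated f → AlgebraicGeometry.LocallyOfFiniteType f → AlgebraicGeometry.QuasiCompact f → AlgebraicGeometry.IsIntegral Y → Literature.AlgebraicGeometry.Resolution.Scheme.IsRegular Y → AlgebraicGeometry.IsIntegral X → AlgebraicGeometry.IsFinite g → AlgebraicGeometry.UniversallyInjective g → Function.Surjective g.base → Literature.AlgebraicGeometry.Resolution.Scheme.HasResolution X) → ∀ (k : Type) [Field k] [CharP k p] (X X'' : AlgebraicGeometry.Scheme.{0}) (f : X ⟶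 AlgebraicGeometry.Spec (.of k)) (g : X'' ⟶ X), AlgebraicGeometry.IsSeparated f → AlgebraicGeometry.LocallyOfFiniteType f → AlgebraicGeometry.QuasiCompact f → AlgebraicGeometry.IsIntegral X → AlgebraicGeometry.IsIntegral X'' → AlgebraicGeometry.IsFinite g → AlgebraicGeometry.UniversallyInjective g → Function.Surjective g.base → Literature.AlgebraicGeometry.Resolution.Scheme.HasResolution X'' → Literature.AlgebraicGeometry.Resolution.Scheme.HasResolution X

-- `PicoverToRadicialBottom` holds: proved by `Summit.ResolutionOfSingularities.ResolutionOfSingularities.Theorems.picoverToRadicialBottom_proof` @ 3180486c3e53 (its module imports this route file, so no `_holds` link can be stated here).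

/-- item stmt-ResolutionOfSingularities-0557 · crux · rank 5 · open · by planner
why it might fail: Open for dim R>=4: Spec((R[T]/(T^p-a))_red) is Temkin's alpha_p-torsor model A_0[t]/(t^p-a_1), A_0 regular (Rem 1.3.5(ii)), the e=1 p.i. hypersurface; dim<=3 only (CossartPiltant2019; KM IFP: dim 3); Moh's bound holds for e=1 yet a blow-up can raise the residual order (kangaroo): no termination.
sources: Temkin2013 (arXiv:0804.1554v3 p.4 Rem 1.3.5(ii)-(iii)), CossartPiltant2019 (arXiv:1412.0868 Thm 1.1), HauserPerlega2019 (sec 3: Moh's bound 'is known to be valid for e=1'), Literature.AlgebraicGeometry.Resolution.hasResolution_of_dim_le_three, Literature.Barriers.ResolutionOfSingularities.DimensionFourFrontier, Literature.Barriers.ResolutionOfSingularities.Hauser2003_kangarooShadeIncrease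
Local model of PICover: for k of char p, R a regular finitely generated k-domain and a in R, the
reduced scheme Spec((R[T]/(T^p - a))_red) has a resolution. (Hypersurface t^p = a over a regular
affine base; the case R = k[x_1..x_n], n >= 4 is open.) -/
@[route_item "route-ResolutionOfSingularities-pAlteration", crux]
def PicoverLocalModel : Prop :=
  ∀ p : ℕ, p.Prime → ∀ (k : Type) [Field k] [CharP k p] (R : Type) [CommRing R] [IsDomain R] [Algebra k R], Algebra.FiniteType k R → IsRegularRing R → ∀ a : R, Literature.AlgebraicGeometry.Resolution.Scheme.HasResolution (AlgebraicGeometry.Spec (.of (AdjoinRoot (Polynomial.X ^ p - Polynomial.C a) ⧸ nilradical (AdjoinRoot (Polynomial.X ^ p - Polynomial.C a)))))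

/-- item stmt-ResolutionOfSingularities-0551 · support · rank 6 · closed · proved by Summit.ResolutionOfSingularities.ResolutionOfSingularities.Theorems.descentReducedToIntegral_proof @ 607c4c5337b9 (prover) · by planner
sources: Literature.AlgebraicGeometry.Resolution.hasResolution_of_forall_closeds, Literature.AlgebraicGeometry.Resolution.resolutionInChar_iff_integral, CossartPiltant2019 (arXiv:1412.0868 proof of Prop 4.6 Step 1)
ReducedToIntegral (fixed field k, any characteristic): if every integral separated finite-type
k-scheme has a resolution then every reduced separated finite-type k-scheme has one (resolve the
irreducible components with reduced structure and take the disjoint union; it is an isomorphism over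
the dense open of points lying on exactly one component). Folklore. -/
@[route_item "route-ResolutionOfSingularities-pAlteration", crux]
def DescentReducedToIntegral : Prop :=
  ∀ (k : Type) [Field k], (∀ (X : AlgebraicGeometry.Scheme.{0}) (f : X ⟶ AlgebraicGeometry.Spec (.of k)), AlgebraicGeometry.IsSeparated f → AlgebraicGeometry.LocallyOfFiniteType f → AlgebraicGeometry.QuasiCompact f → AlgebraicGeometry.IsIntegral X → Literature.AlgebraicGeometry.Resolution.Scheme.HasResolution X) → ∀ (X : AlgebraicGeometry.Scheme.{0}) (f : X ⟶ AlgebraicGeometry.Spec (.of k)), AlgebraicGeometry.IsSeparated f → AlgebraicGeometry.LocallyOfFiniteType f → AlgebraicGeometry.QuasiCompact f → AlgebraicGeometry.IsReduced X → Literature.AlgebraicGeometry.Resolution.Scheme.HasResolution X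

/-- `DescentReducedToIntegral` holds: proved by `Summit.ResolutionOfSingularities.ResolutionOfSingularities.Theorems.descentReducedToIntegral_proof` @ 607c4c5337b9. -/
theorem DescentReducedToIntegral_holds : DescentReducedToIntegral := _root_.Summit.ResolutionOfSingularities.ResolutionOfSingularities.Theorems.descentReducedToIntegral_proof

/-- item stmt-ResolutionOfSingularities-10476 · assembly · rank 1 · closed · proved by Summit.ResolutionOfSingularities.ResolutionOfSingularities.Theorems.assembly2_proof (prover) · by planner
[assembly] By-name assembly frame (supersedes the rev-2 Assembly
stmt-ResolutionOfSingularities-0553, whose hypothesis inlined the thesis body and drew the gate's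
glue.extra-hypothesis): PalterationThesis → PicoverToRadicialBottom → DescentReducedToIntegral →
ResolutionOfSingularities. RadicialBottom (via 0556) and reduced→integral (0551) are explicit
hypotheses, so the content of THIS item is true on paper for EVERY ground field k (no F-finiteness;
refuter g2-0 on 0553, 2026-08-13): fix a prime p and put RB_p := h0556 p hp (hT p hp).2 (0556's
inline PICover antecedent is the thesis' second conjunct verbatim). For X reduced separated f.t./k:
0551 reduces to X integral; Scheme.HasResolution.of_normalization (in tree,
SurfaceResolutionReduction.lean, with NoetherFiniteIntegralClosure_holds) reduces to X NORMAL
(normalise first: for the nodal cubic the finite part of the alteration has two points over the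
node, refuter pool-5); PIAlt_p = (hT p hp).1 on X gives g : X' → X proper surjective, X' integral
regular, finite and universally injective over a dense open U; factor g = h ∘ g' through X'' :=
normalization of X in K(X') (in tree: normalizationIn / normalizationInι, finite by isFini -/
@[route_item "route-ResolutionOfSingularities-pAlteration", crux]
def Assembly2 : Prop :=
  PalterationThesis → PicoverToRadicialBottom → DescentReducedToIntegral → _root_.ResolutionOfSingularities

-- `Assembly2` holds: proved by `Summit.ResolutionOfSingularities.ResolutionOfSingularities.Theorems.assembly2_proof` (its module imports this route file, so no `_holds` link can be stated here).

-- records of items no longer active in this route (dropped / restated):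
-- earlier Assembly (stmt-ResolutionOfSingularities-0553, dropped 2026-08-16T14:43:06Z): proved by Summit.ResolutionOfSingularities.ResolutionOfSingularities.Theorems.assembly_proof — (∀ p : ℕ, p.Prime → (∀ (k : Type) [Field k] [CharP k p] (X : AlgebraicGeometry.Scheme.{0}) (f : X ⟶ AlgebraicGeometry.Spec (.of k)), AlgebraicGeometry.IsSeparated f → AlgebraicGeometry.LocallyOfFiniteType f → AlgebraicG

/-! D-0027 §2.1 — DECIDING THEOREM (planner-authored via `route open/edit --closes-file`; by planner-rbadge-ResolutionOfSingularities-pAlte-07727138-g2-0 2026-08-15T16:24:54Z):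
its hypotheses are this route's items and its conclusion the sub-problem Statement (glue_lint), and it elaborates with this file. -/

/-- D-0027 §2.1 deciding theorem of route pAlteration: the listed items imply the summit statement
`ResolutionOfSingularities` (by name). Pure logic: the by-name assembly frame `Assembly2` consumes the
thesis (PIAlt ∧ PICover for every prime), the radicial-bottom reduction and the reduced→integral
reduction; the remaining items (the two cruxes separately, the local model) are listed hypotheses of
the route and need not be used here. -/
@[closes "route-ResolutionOfSingularities-pAlteration"] theorem closes (hT : PalterationThesis) (hPc : Picover) (hPi : Pialt)
    (hRB : PicoverToRadicialBottom) (hLM : PicoverLocalModel) (hD : DescentReducedToIntegral)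
    (hA2 : Assembly2) : _root_.ResolutionOfSingularities :=
  hA2 hT hRB hD

end Summit.ResolutionOfSingularities.ResolutionOfSingularities.Theses.PAlteration
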